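import Summits.QuantumFields.YangMills.Theorems.BalabanUVNodesN14ConvexFibreStep
import Literature.Analysis.FunctionSpaces.UniformlyConvexLogSobolevDomain

/-!
# BalabanUVNodes ∕ node N14 = NE1′ — THE SMALL-FIELD BOX: the convex-fibre engine for an action convex ON A CONVEX BOX
# (Bobkov–Ledoux's convex-domain Bakry–Émery inequality, PROVED in the tree, consumed BY NAME through the glue, Herbst and the step)

Cell `pub-ymgap`, HUMAN RULING D-0062 (Track A at full width), seat `pub-ymgap-dag-n14-c` (R134 ACCELERATION, strategy s1), generation 4;
route `Summits/QuantumFields/YangMills/Theses/BalabanUVNodes.lean` (cluster K3′ `SpineGivenEndpointR12`, `--supports … --as helper`); venue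
ruling R424 (`YangMills/Theorems`, namespace `YMDAG.N14.ConvexFibreBox`).  Fourth file of the convex-fibre engine (A `…ConvexFibreEngine`, B
`…ConvexFibreWindow`, C `…ConvexFibreStep`).  Bałaban's small-field fluctuation fields are CONSTRAINED TO A BOX (`|field| ≤ p(k)`), so the
realistic fibre law is `1_Ω e^{−V}dx ∕ ∫_Ω e^{−V}` with `V` uniformly convex ON `Ω` only.  The literature desk's ME #14 (ii′) became
`Literature/Analysis/FunctionSpaces/UniformlyConvexLogSobolevDomain.lean` (node00-def-RR-2, p480392 ✓ — Bobkov–Ledoux 2000 Prop. 3.1 + remark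
p. 1038 PROVED, schemas `HasEntropyExpC1c` ∕ `HasLogSobolevC1c`): this file CONSUMES it by name.  ADDITIVE — imports file C and that
Literature file; THEOREMS ONLY (0 `def`), modifies nothing.

WHAT THIS IS.
* §1 THE SCHEMA-LEVEL BRIDGE [folklore ∘ cite: BakryGentilLedoux2014, Prop. 5.4.1]: `hasSubgaussianMGF_of_hasEntropyExpC1c` — RR-2's schema
  `HasEntropyExpC1c ν C` (`C > 0`) + a BOUNDED `C¹` observable with `‖DG‖ ≤ L` ⇒ `HasSubgaussianMGF (G − ∫G dν) ⟨C·L²⟩ ν` (file A's glue +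
  Herbst; RR-2's own `HasEntropyExpC1c.hasSubgaussianMGF` is the `C¹_c` case); `bornCumulant_le_of_hasEntropyExpC1c`.
* §2 THE BOX FIBRE [cite: BobkovLedoux2000, Prop. 3.1 (p. 1034) + remark p. 1038 — PROVED in the tree by node00-def-RR-2]:
  `isProbabilityMeasure_restrict_tilted`; **`hasSubgaussianMGF_box_of_uniformlyConvexOn`** — `Ω` open convex with `volume Ω ≠ 0`, `V`
  continuous and `c`-uniformly convex ON `Ω` (first-order letter with any field), `e^{−V}` integrable on `Ω`, `G ∈ C¹` bounded with `‖DG‖ ≤ L`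
  ⇒ under `ν_Ω = (volume.restrict Ω).tilted (−V)` the observable is sub-Gaussian about its mean with parameter `L²∕c` — the SAME constant as
  on the whole space (no boundary loss); `hasSubgaussianMGF_convexSet_of_uniformlyConvex` (whole-space convex `V` conditioned on ANY convex `B`
  with `volume B ≠ 0`, Bobkov–Ledoux p. 1038); `bornCumulant_box_le` (`cgf G ν_Ω t − t·∫G dν_Ω ≤ (L²∕c)·t²∕2`).
* §3 THE STEP WITH BOX FIBRES [folklore ∘ file C]: `fibre_mgf_le_box` + **`hasSubgaussianMGF_compProd_of_boxFibres`** — a background law `ν`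
  composed with a fibre kernel whose EVERY fibre is a box law `(volume.restrict (Ω b)).tilted (−V (b,·))`, `c`-convex on its box uniformly in
  the background, adds `L²∕c` to the dressed observable's sub-Gaussian parameter (`c₀ + L²∕c`); `bornCumulant_boxStep_le`.

WHAT THIS IS NOT.  Everything here is PROVED (0 `sorry`, 0 named facts — RR-2's Bobkov–Ledoux theorems are kernel theorems).  HYPOTHESIS in any
application: Bałaban's history-conditioned small-field fibre actions ARE `c`-uniformly convex on their boxes, uniformly in the history (NODE O's
located positivity statement), and the fibre gradient of the pulled-back observable is `L₀θ₁^k`.  Nothing of Bałaban's instantiated; N14 NOT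
discharged; K3′ ∕ `TiltedMeanMatching` NOT instantiated; count-neutral.  One finite four-torus programme at fixed ε; NOT ℝ⁴, NOT OS, NOT a
mass gap, NOT Clay.
-/

noncomputable section

namespace YMDAG.N14.ConvexFibreBox

open MeasureTheory ProbabilityTheory Set Filter Topology
open scoped RealInnerProductSpace ENNReal NNReal
open Literature.Analysis.FunctionSpaces (HasEntropyExpC1c bobkovLedoux2000_prop31_convexDomain_exp bobkovLedoux2000_p1038_convexSet_exp)
open YMDAG.N14.CovGradEngine (bornCumulant_le_of_hasSubgaussianMGF)
open YMDAG.N14.ConvexFibreEngine (hasSubgaussianMGF_of_entropyC1c)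
open YMDAG.N14.ConvexFibreStep (hasSubgaussianMGF_compProd_of_fibre)

variable {n : ℕ}

/-! ## §1 The schema-level bridge: RR-2's `HasEntropyExpC1c` ⇒ Herbst for bounded `C¹` observables -/
section Schema

variable {ν : Measure (EuclideanSpace ℝ (Fin n))} [IsProbabilityMeasure ν] {C : ℝ} {G : EuclideanSpace ℝ (Fin n) → ℝ} {B L : ℝ}

/-- **THE BRIDGE** [folklore ∘ cite: BakryGentilLedoux2014, Prop. 5.4.1].  A probability law `ν` on `ℝⁿ` with the exponential schema
`HasEntropyExpC1c ν C` (`C > 0`, node00-def-RR-2's `UniformlyConvexLogSobolevDomain`) makes every BOUNDED `C¹` observable with `‖DG‖ ≤ L`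
(`L > 0`) sub-Gaussian about its mean with parameter `C·L²` — file A's glue (`C¹_c` → bounded `C¹`) and Herbst; the schema is definitionally
file A's inline hypothesis. -/
theorem hasSubgaussianMGF_of_hasEntropyExpC1c (h : HasEntropyExpC1c ν C) (hC : 0 < C) (hG : ContDiff ℝ 1 G) (hGb : ∀ x, |G x| ≤ B)
    (hGD : ∀ x, ‖fderiv ℝ G x‖ ≤ L) (hL : 0 < L) :
    HasSubgaussianMGF (fun x => G x - ∫ z, G z ∂ν) ⟨C * L ^ 2, by positivity⟩ ν :=
  hasSubgaussianMGF_of_entropyC1c hC (fun φ hφ hφs => h φ hφ hφs) hG hGb hGD hL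

/-- **THE BORN CUMULANT UNDER THE SCHEMA** [folklore]: `cgf G ν t − t·∫G dν ≤ (C·L²)·t²∕2` for every real `t`. -/
theorem bornCumulant_le_of_hasEntropyExpC1c (h : HasEntropyExpC1c ν C) (hC : 0 < C) (hG : ContDiff ℝ 1 G) (hGb : ∀ x, |G x| ≤ B)
    (hGD : ∀ x, ‖fderiv ℝ G x‖ ≤ L) (hL : 0 < L) (t : ℝ) :
    cgf G ν t - t * ∫ z, G z ∂ν ≤ C * L ^ 2 * t ^ 2 / 2 := by
  have hb := bornCumulant_le_of_hasSubgaussianMGF (hasSubgaussianMGF_of_hasEntropyExpC1c h hC hG hGb hGD hL) t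
  exact_mod_cast hb

end Schema

/-! ## §2 The box fibre: `1_Ω e^{−V}dx ∕ Z_Ω` with `V` convex on the convex box `Ω` only -/
section Box

variable {Ω : Set (EuclideanSpace ℝ (Fin n))} {V G : EuclideanSpace ℝ (Fin n) → ℝ} {W : EuclideanSpace ℝ (Fin n) → EuclideanSpace ℝ (Fin n)}
  {c B L : ℝ}

/-- The box law `(volume.restrict Ω).tilted (−V)` is a probability measure when `volume Ω ≠ 0` and `e^{−V}` is integrable on `Ω`. [folklore] -/
theorem isProbabilityMeasure_restrict_tilted (hΩ0 : volume Ω ≠ 0) (hZ : IntegrableOn (fun x => Real.exp (-V x)) Ω) :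
    IsProbabilityMeasure (((volume : Measure (EuclideanSpace ℝ (Fin n))).restrict Ω).tilted fun x => -V x) := by
  haveI : NeZero ((volume : Measure (EuclideanSpace ℝ (Fin n))).restrict Ω) := ⟨by rwa [Ne, Measure.restrict_eq_zero]⟩
  exact isProbabilityMeasure_tilted hZ

/-- **THE BOX FIBRE IS SUB-GAUSSIAN IN GRADIENT CURRENCY, SAME CONSTANT AS THE WHOLE SPACE** [cite: BobkovLedoux2000, Prop. 3.1 (p. 1034) —
PROVED in the tree as `bobkovLedoux2000_prop31_convexDomain_exp` (node00-def-RR-2); Herbst: BakryGentilLedoux2014, Prop. 5.4.1].  `Ω` open and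
convex with `volume Ω ≠ 0`; `V` continuous on `Ω` and `c`-uniformly convex ON `Ω` in the first-order letter (any field `W`); `e^{−V}` integrable
on `Ω`; `G ∈ C¹` with `|G| ≤ B`, `‖DG‖ ≤ L`, `L > 0`.  Then under the box law `ν_Ω = (volume.restrict Ω).tilted (−V)`:
`HasSubgaussianMGF (G − ∫G dν_Ω) ⟨L²∕c⟩ ν_Ω` — no boundary loss, the small-field constraint costs nothing in this currency. -/
theorem hasSubgaussianMGF_box_of_uniformlyConvexOn (hΩo : IsOpen Ω) (hΩc : Convex ℝ Ω) (hΩ0 : volume Ω ≠ 0) (hc : 0 < c)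
    (hVc : ContinuousOn V Ω) (hV : ∀ x ∈ Ω, ∀ y ∈ Ω, V x + ⟪W x, y - x⟫ + c / 2 * ‖y - x‖ ^ 2 ≤ V y)
    (hZ : IntegrableOn (fun x => Real.exp (-V x)) Ω) (hG : ContDiff ℝ 1 G) (hGb : ∀ x, |G x| ≤ B) (hGD : ∀ x, ‖fderiv ℝ G x‖ ≤ L)
    (hL : 0 < L) :
    HasSubgaussianMGF (fun x => G x - ∫ z, G z ∂((volume.restrict Ω).tilted fun x => -V x)) ⟨L ^ 2 / c, by positivity⟩
      ((volume.restrict Ω).tilted fun x => -V x) := by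
  haveI := isProbabilityMeasure_restrict_tilted hΩ0 hZ
  have h := hasSubgaussianMGF_of_hasEntropyExpC1c (bobkovLedoux2000_prop31_convexDomain_exp hΩo hΩc hc hVc hV hZ) (one_div_pos.2 hc)
    hG hGb hGD hL
  have e : (⟨1 / c * L ^ 2, by positivity⟩ : ℝ≥0) = ⟨L ^ 2 / c, by positivity⟩ := by
    ext
    push_cast
    ring
  rwa [e] at h

/-- **A WHOLE-SPACE CONVEX ACTION CONDITIONED ON ANY CONVEX BOX** [cite: BobkovLedoux2000, remark p. 1038 (μ_B) — PROVED in the tree as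
`bobkovLedoux2000_p1038_convexSet_exp`].  `V` continuous and `c`-uniformly convex on all of `ℝⁿ`, `e^{−V}` integrable, `B` ANY convex set with
`volume B ≠ 0`; `G ∈ C¹` with `|G| ≤ B'`, `‖DG‖ ≤ L`, `L > 0`.  Then under `(volume.restrict B).tilted (−V)` the observable is sub-Gaussian about
its mean with parameter `L²∕c` — the constant UNCHANGED by the conditioning. -/
theorem hasSubgaussianMGF_convexSet_of_uniformlyConvex {Bx : Set (EuclideanSpace ℝ (Fin n))} {B' : ℝ} (hB : Convex ℝ Bx)
    (hB0 : volume Bx ≠ 0) (hc : 0 < c) (hVc : Continuous V)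
    (hV : ∀ x y : EuclideanSpace ℝ (Fin n), V x + ⟪W x, y - x⟫ + c / 2 * ‖y - x‖ ^ 2 ≤ V y) (hZ : Integrable fun x => Real.exp (-V x))
    (hG : ContDiff ℝ 1 G) (hGb : ∀ x, |G x| ≤ B') (hGD : ∀ x, ‖fderiv ℝ G x‖ ≤ L) (hL : 0 < L) :
    HasSubgaussianMGF (fun x => G x - ∫ z, G z ∂((volume.restrict Bx).tilted fun x => -V x)) ⟨L ^ 2 / c, by positivity⟩
      ((volume.restrict Bx).tilted fun x => -V x) := by
  haveI := isProbabilityMeasure_restrict_tilted hB0 hZ.integrableOn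
  have h := hasSubgaussianMGF_of_hasEntropyExpC1c (bobkovLedoux2000_p1038_convexSet_exp hB hc hVc hV hZ) (one_div_pos.2 hc) hG hGb hGD hL
  have e : (⟨1 / c * L ^ 2, by positivity⟩ : ℝ≥0) = ⟨L ^ 2 / c, by positivity⟩ := by
    ext
    push_cast
    ring
  rwa [e] at h

/-- **THE BORN CUMULANT OF ONE BOX FIBRE** [folklore ∘ the cited, proved facts]: under the hypotheses of
`hasSubgaussianMGF_box_of_uniformlyConvexOn`, `cgf G ν_Ω t − t·∫G dν_Ω ≤ (L²∕c)·t²∕2` for every real `t`. -/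
theorem bornCumulant_box_le (hΩo : IsOpen Ω) (hΩc : Convex ℝ Ω) (hΩ0 : volume Ω ≠ 0) (hc : 0 < c) (hVc : ContinuousOn V Ω)
    (hV : ∀ x ∈ Ω, ∀ y ∈ Ω, V x + ⟪W x, y - x⟫ + c / 2 * ‖y - x‖ ^ 2 ≤ V y) (hZ : IntegrableOn (fun x => Real.exp (-V x)) Ω)
    (hG : ContDiff ℝ 1 G) (hGb : ∀ x, |G x| ≤ B) (hGD : ∀ x, ‖fderiv ℝ G x‖ ≤ L) (hL : 0 < L) (t : ℝ) :
    cgf G ((volume.restrict Ω).tilted fun x => -V x) t - t * ∫ z, G z ∂((volume.restrict Ω).tilted fun x => -V x) ≤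
      L ^ 2 / c * t ^ 2 / 2 := by
  haveI := isProbabilityMeasure_restrict_tilted hΩ0 hZ
  have hb := bornCumulant_le_of_hasSubgaussianMGF (hasSubgaussianMGF_box_of_uniformlyConvexOn hΩo hΩc hΩ0 hc hVc hV hZ hG hGb hGD hL) t
  exact_mod_cast hb

end Box

/-! ## §3 The step with box fibres: every fibre a box law, convex on its box uniformly in the background -/
section BoxStep

variable {Bk : Type*} [MeasurableSpace Bk] {ν : Measure Bk} [IsProbabilityMeasure ν] {κ : Kernel Bk (EuclideanSpace ℝ (Fin n))}
  [IsMarkovKernel κ] {Ω : Bk → Set (EuclideanSpace ℝ (Fin n))} {V G : Bk × EuclideanSpace ℝ (Fin n) → ℝ}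
  {W : Bk → EuclideanSpace ℝ (Fin n) → EuclideanSpace ℝ (Fin n)} {c B₀ L : ℝ}

omit [IsProbabilityMeasure ν] [IsMarkovKernel κ] in
/-- **THE FIBRE HYPOTHESIS FOR BOX FIBRES, UNIFORMLY IN THE BACKGROUND** [cite: BobkovLedoux2000, Prop. 3.1 — PROVED in the tree; §2 fibre by
fibre].  Every fibre law a box law `κ b = (volume.restrict (Ω b)).tilted (−V (b,·))` with `Ω b` open convex of nonzero volume, `V (b,·)`
continuous and `c`-convex on `Ω b`, `e^{−V(b,·)}` integrable on `Ω b`; `G (b,·) ∈ C¹` with `|G| ≤ B₀` and fibre gradient `≤ L` (`L > 0`).  Then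
`∫ e^{t(G(b,·) − avg b)} ∂(κ b) ≤ e^{(L²∕c)·t²∕2}` for every `b` and `t`. -/
theorem fibre_mgf_le_box (hκ : ∀ b, κ b = ((volume : Measure (EuclideanSpace ℝ (Fin n))).restrict (Ω b)).tilted fun x => -V (b, x))
    (hΩo : ∀ b, IsOpen (Ω b)) (hΩc : ∀ b, Convex ℝ (Ω b)) (hΩ0 : ∀ b, volume (Ω b) ≠ 0) (hc : 0 < c)
    (hVc : ∀ b, ContinuousOn (fun x => V (b, x)) (Ω b))
    (hV : ∀ b, ∀ x ∈ Ω b, ∀ y ∈ Ω b, V (b, x) + ⟪W b x, y - x⟫ + c / 2 * ‖y - x‖ ^ 2 ≤ V (b, y))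
    (hZ : ∀ b, IntegrableOn (fun x => Real.exp (-V (b, x))) (Ω b)) (hG : ∀ b, ContDiff ℝ 1 fun x => G (b, x))
    (hGb : ∀ p, |G p| ≤ B₀) (hGD : ∀ b x, ‖fderiv ℝ (fun z => G (b, z)) x‖ ≤ L) (hL : 0 < L) (b : Bk) (t : ℝ) :
    ∫ x, Real.exp (t * (G (b, x) - ∫ y, G (b, y) ∂(κ b))) ∂(κ b) ≤ Real.exp (↑(⟨L ^ 2 / c, by positivity⟩ : ℝ≥0) * t ^ 2 / 2) := by
  have h := (hasSubgaussianMGF_box_of_uniformlyConvexOn (hΩo b) (hΩc b) (hΩ0 b) hc (hVc b) (hV b) (hZ b) (hG b) (fun x => hGb (b, x))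
    (hGD b) hL).mgf_le t
  rw [hκ b]
  exact h

/-- **ONE RENORMALISATION STEP WITH BOX FIBRES** [folklore ∘ the cited, proved facts].  Background law `ν`, Markov fibre kernel with every
fibre a box law as in `fibre_mgf_le_box`, observable `G` measurable with `|G| ≤ B₀`; the fibre average sub-Gaussian about its mean with
parameter `c₀` under `ν`.  Then `G` is sub-Gaussian about its mean under `ν ⊗ₘ κ` with parameter `c₀ + L²∕c` — file C's step, the fibre
parameter supplied by Bobkov–Ledoux on the boxes. -/
theorem hasSubgaussianMGF_compProd_of_boxFibres {c₀ : ℝ≥0}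
    (hκ : ∀ b, κ b = ((volume : Measure (EuclideanSpace ℝ (Fin n))).restrict (Ω b)).tilted fun x => -V (b, x))
    (hΩo : ∀ b, IsOpen (Ω b)) (hΩc : ∀ b, Convex ℝ (Ω b)) (hΩ0 : ∀ b, volume (Ω b) ≠ 0) (hc : 0 < c)
    (hVc : ∀ b, ContinuousOn (fun x => V (b, x)) (Ω b))
    (hV : ∀ b, ∀ x ∈ Ω b, ∀ y ∈ Ω b, V (b, x) + ⟪W b x, y - x⟫ + c / 2 * ‖y - x‖ ^ 2 ≤ V (b, y))
    (hZ : ∀ b, IntegrableOn (fun x => Real.exp (-V (b, x))) (Ω b)) (hGm : Measurable G) (hG : ∀ b, ContDiff ℝ 1 fun x => G (b, x))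
    (hGb : ∀ p, |G p| ≤ B₀) (hGD : ∀ b x, ‖fderiv ℝ (fun z => G (b, z)) x‖ ≤ L) (hL : 0 < L)
    (hbase : HasSubgaussianMGF (fun b => (∫ x, G (b, x) ∂(κ b)) - ∫ b', (∫ x, G (b', x) ∂(κ b')) ∂ν) c₀ ν) :
    HasSubgaussianMGF (fun p => G p - ∫ q, G q ∂(ν ⊗ₘ κ)) (c₀ + ⟨L ^ 2 / c, by positivity⟩) (ν ⊗ₘ κ) :=
  hasSubgaussianMGF_compProd_of_fibre hGm hGb hbase (fibre_mgf_le_box hκ hΩo hΩc hΩ0 hc hVc hV hZ hG hGb hGD hL)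

/-- **THE BORN CUMULANT AFTER ONE BOX STEP** [folklore]: under the hypotheses of `hasSubgaussianMGF_compProd_of_boxFibres`,
`cgf G (ν ⊗ₘ κ) t − t·∫G d(ν ⊗ₘ κ) ≤ (c₀ + L²∕c)·t²∕2` for every real `t`. -/
theorem bornCumulant_boxStep_le {c₀ : ℝ≥0}
    (hκ : ∀ b, κ b = ((volume : Measure (EuclideanSpace ℝ (Fin n))).restrict (Ω b)).tilted fun x => -V (b, x))
    (hΩo : ∀ b, IsOpen (Ω b)) (hΩc : ∀ b, Convex ℝ (Ω b)) (hΩ0 : ∀ b, volume (Ω b) ≠ 0) (hc : 0 < c)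
    (hVc : ∀ b, ContinuousOn (fun x => V (b, x)) (Ω b))
    (hV : ∀ b, ∀ x ∈ Ω b, ∀ y ∈ Ω b, V (b, x) + ⟪W b x, y - x⟫ + c / 2 * ‖y - x‖ ^ 2 ≤ V (b, y))
    (hZ : ∀ b, IntegrableOn (fun x => Real.exp (-V (b, x))) (Ω b)) (hGm : Measurable G) (hG : ∀ b, ContDiff ℝ 1 fun x => G (b, x))
    (hGb : ∀ p, |G p| ≤ B₀) (hGD : ∀ b x, ‖fderiv ℝ (fun z => G (b, z)) x‖ ≤ L) (hL : 0 < L)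
    (hbase : HasSubgaussianMGF (fun b => (∫ x, G (b, x) ∂(κ b)) - ∫ b', (∫ x, G (b', x) ∂(κ b')) ∂ν) c₀ ν) (t : ℝ) :
    cgf G (ν ⊗ₘ κ) t - t * ∫ q, G q ∂(ν ⊗ₘ κ) ≤ (c₀ + L ^ 2 / c) * t ^ 2 / 2 := by
  have h := bornCumulant_le_of_hasSubgaussianMGF
    (hasSubgaussianMGF_compProd_of_boxFibres hκ hΩo hΩc hΩ0 hc hVc hV hZ hGm hG hGb hGD hL hbase) t
  exact_mod_cast h

end BoxStep

end YMDAG.N14.ConvexFibreBox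

end
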